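import Summits.AtomisticToContinuum.Crystallization.Theorems.OverbindingBudgetAffineRunCutFlat
import Summits.AtomisticToContinuum.Crystallization.Theorems.OverbindingBudgetAffineRunCutPairBook

/-!
# `OverbindingBudget` / crux `RobustDefectLimitWindows` (stmt-AtomisticToContinuum-31280) — «RunCut» SW♭: the assembly SOCKET

Support file (lens-4 g87, hand-in 3 item 2 «C-XASM», second half; memo `HOME/decomp-a2c-lens-4/g87/memo/SW-CHI.md` §6).  The competitor leaf
**SW♭** = `StackSwapGainFlatWide` (`…RunCutFlat`) asks, for every window `[δ, 2]`, for constants `c > 0, C` and, for EVERY injective configuration `y`,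
an injective competitor `y'` obeying the mover clause and the energy inequality.  This file fixes — as ONE named `Prop`, `Socket` — exactly what the
construction files S1–S6 (slip map, letters, class bounds, budget) must deliver PER CONFIGURATION, and proves, from the pair bookkeeping of
`…RunCutPairBook`, that the socket gives the leaf:

* `Socket … σ₁ σ₂ c C y` (definition): there are finitely many patches `π : Fin N → Option (Fin m)`, letter vectors `w : Fin N → Fin 3 → E3` and
  class bounds `B` with (S1) patch sites eligible (`DeepReg r ε g ∧ CFramed ε g ∧ InWindow σ₁ σ₂`), (S1) letter vectors at most `nn` long and
  SHORTER than the distance to every other site, (S1) no mover–mover collision, (S2–S5) `avgDelta lennardJones y π w i j ≤ B i j` for `i < j`, and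
  (S6, the budget) `Σ_{i<j} B i j + c·#rigidRun ≤ C·(#compressedRun + #wildRun) + C·#fine + C·#notDeep + C·#off + C·N^{2/3}`;
* ★ `flatW_conclusion_of_socket` — the socket for `y` gives the `StackSwapGainFlatW` conclusion for `y` (competitor `= slip y π w ℓ` for the letter
  assignment `ℓ` of `…PairBook.exists_letters_energy_le_of_bounds`; injectivity `slip_injective`; mover clause `mover_clause`);
* ★ `stackSwapGainFlatW_of_socket` — `0 < c ∧ (∀ N y, Injective y → Socket … c C y) → StackSwapGainFlatW …`;
* ★ `stackSwapGainFlatWide_of_socket` — the record leaf from a socket on every window `[δ, 2]` (constants may depend on `δ`).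
No analysis here: the per-column lines (ideal TRIPLE gain `…AxialWindowProfile`, chirality `…ChiralityLink`, c/a and roughness lanes, far matter
`…Forgone`/`…FarCone`, cross-patch `…CrossPatch`) all enter through `B` and the budget line (S6).
[this file: 1 definition (`Socket`), 3 theorems; standard axioms]
-/

noncomputable section

namespace Summit.AtomisticToContinuum.Crystallization.Theorems.OverbindingBudgetAffineRunCutFlatSocket

open scoped BigOperators
open Finset (Ioi)
open Literature.MathematicalPhysics.StatisticalMechanics (interactionEnergy lennardJones)
open Literature.Geometry.DiscreteGeometry (nearestDist)
open Summit.AtomisticToContinuum.Crystallization.Theorems.ChargedEnergyGapNegative (E3)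
open Summit.AtomisticToContinuum.Crystallization.Theorems.OverbindingBudgetMisfitRegistration (DeepReg)
open Summit.AtomisticToContinuum.Crystallization.Theorems.OverbindingBudgetMisfitWindowStatements (InWindow offCount)
open Summit.AtomisticToContinuum.Crystallization.Theorems.OverbindingBudgetBalancedCensusStatements (notDeepCount)
open Summit.AtomisticToContinuum.Crystallization.Theorems.OverbindingBudgetAffinePhaseCut (CFramed)
open Summit.AtomisticToContinuum.Crystallization.Theorems.OverbindingBudgetAffineRunCut (rigidRunCount compressedRunCount wildRunCount)
open Summit.AtomisticToContinuum.Crystallization.Theorems.OverbindingBudgetAffineRunCutFlat (fineCount StackSwapGainFlatW TameStackSwapGainFlat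
  StackSwapGainFlatWide)
open Summit.AtomisticToContinuum.Crystallization.Theorems.OverbindingBudgetAffineRunCutPairBook

variable {N : ℕ}

/-! ## §1. The socket -/

/-- **`Socket ρ ρ₁ η θ₀ s₀ s₁ ε g r rh σ₁ σ₂ c C y`** — what S1–S6 deliver for ONE configuration `y`: `m` patches `π`, letter vectors `w`, class
bounds `B`, with eligibility, length, separation and non-collision of the letter vectors (S1), the class bounds (S2–S5) and the budget (S6).
[this file · kind: statement (socket: the per-configuration deliverable of S1–S6; `stackSwapGainFlatWide_of_socket` turns it into SW♭)] -/
def Socket (ρ ρ₁ η θ₀ s₀ s₁ ε g r rh σ₁ σ₂ c C : ℝ) (y : Fin N → E3) : Prop :=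
  ∃ (m : ℕ) (π : Fin N → Option (Fin m)) (w : Fin N → Fin 3 → E3) (B : Fin N → Fin N → ℝ),
    (∀ i k, π i = some k → DeepReg r ε g y i ∧ CFramed ε g y i ∧ InWindow σ₁ σ₂ y i) ∧
    (∀ i k, π i = some k → ∀ a, ‖w i a‖ ≤ nearestDist y i) ∧
    (∀ i k, π i = some k → ∀ a, ∀ j, j ≠ i → ‖w i a‖ < dist (y i) (y j)) ∧
    (∀ i j k k', i ≠ j → π i = some k → π j = some k' → ∀ a b, y i + w i a ≠ y j + w j b) ∧
    (∀ i j, i < j → avgDelta lennardJones y π w i j ≤ B i j) ∧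
    ∑ i, ∑ j ∈ Ioi i, B i j + c * (rigidRunCount ρ ρ₁ η θ₀ s₁ ε g r rh y : ℝ)
      ≤ C * ((compressedRunCount ρ ρ₁ η θ₀ s₁ ε g r rh y + wildRunCount ρ ρ₁ η θ₀ ε g r rh y : ℕ) : ℝ)
        + C * (fineCount ρ ε g s₀ σ₁ y : ℝ) + C * (notDeepCount ρ ε g y : ℝ) + C * (offCount σ₁ σ₂ y : ℝ) + C * (N : ℝ) ^ (2 / 3 : ℝ)

/-! ## §2. ★ The socket gives the leaf -/

/-- ★ **The socket for `y` gives the `StackSwapGainFlatW` conclusion for `y`.** [this file · kind: proof] -/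
theorem flatW_conclusion_of_socket {ρ ρ₁ η θ₀ s₀ s₁ ε g r rh σ₁ σ₂ c C : ℝ} {y : Fin N → E3} (hy : Function.Injective y)
    (h : Socket ρ ρ₁ η θ₀ s₀ s₁ ε g r rh σ₁ σ₂ c C y) :
    ∃ y' : Fin N → E3, Function.Injective y' ∧
      (∀ i : Fin N, y' i ≠ y i → (DeepReg r ε g y i ∧ CFramed ε g y i ∧ InWindow σ₁ σ₂ y i) ∧ dist (y' i) (y i) ≤ nearestDist y i) ∧
      interactionEnergy lennardJones y' + c * (rigidRunCount ρ ρ₁ η θ₀ s₁ ε g r rh y : ℝ)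
        ≤ interactionEnergy lennardJones y
          + C * ((compressedRunCount ρ ρ₁ η θ₀ s₁ ε g r rh y + wildRunCount ρ ρ₁ η θ₀ ε g r rh y : ℕ) : ℝ)
          + C * (fineCount ρ ε g s₀ σ₁ y : ℝ)
          + C * (notDeepCount ρ ε g y : ℝ) + C * (offCount σ₁ σ₂ y : ℝ) + C * (N : ℝ) ^ (2 / 3 : ℝ) := by
  obtain ⟨m, π, w, B, hP, hR, h1, h2, hB, hsum⟩ := h
  obtain ⟨ℓ, hℓ⟩ := exists_letters_energy_le_of_bounds lennardJones y π w B hB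
  exact ⟨slip y π w ℓ, slip_injective hy h1 h2 ℓ, fun i hi => mover_clause (P := fun i => DeepReg r ε g y i ∧ CFramed ε g y i ∧ InWindow σ₁ σ₂ y i)
    hP hR ℓ i hi, by linarith⟩

/-- ★ **`SW♭_W` from a uniform socket.** [this file · kind: proof] -/
theorem stackSwapGainFlatW_of_socket {ρ ρ₁ η θ₀ s₀ s₁ ε g r rh σ₁ σ₂ : ℝ} (c C : ℝ) (hc : 0 < c)
    (h : ∀ (N : ℕ) (y : Fin N → E3), Function.Injective y → Socket ρ ρ₁ η θ₀ s₀ s₁ ε g r rh σ₁ σ₂ c C y) :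
    StackSwapGainFlatW ρ ρ₁ η θ₀ s₀ s₁ ε g r rh σ₁ σ₂ :=
  ⟨c, C, hc, fun N y hy => flatW_conclusion_of_socket hy (h N y hy)⟩

/-- ★ **THE RECORD LEAF FROM THE SOCKET**: a socket (constants depending on the window) on every window `[δ, 2]`, `0 < δ ≤ 2`, at the record literals
gives `StackSwapGainFlatWide`. [this file · kind: proof] -/
theorem stackSwapGainFlatWide_of_socket
    (h : ∀ δ : ℝ, 0 < δ → δ ≤ 2 → ∃ c C : ℝ, 0 < c ∧ ∀ (N : ℕ) (y : Fin N → E3), Function.Injective y →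
      Socket 64 24 (1 / 10 ^ 4) (1 / 1000) (17 / 50) (17 / 20) (3 / 50) (1 / 450) 12 2 δ 2 c C y) :
    StackSwapGainFlatWide := by
  intro δ hδ hδ2
  obtain ⟨c, C, hc, hS⟩ := h δ hδ hδ2
  exact stackSwapGainFlatW_of_socket c C hc hS

end Summit.AtomisticToContinuum.Crystallization.Theorems.OverbindingBudgetAffineRunCutFlatSocket

end
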